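import Summits.QuantumFields.YangMills.Theorems.UnitScaleTiltToronGauge
import Summits.QuantumFields.YangMills.Theorems.UnitScaleTiltSU2FractionalPowers
import HarnessLib

/-!
# `UnitScaleTiltToronGaugeSpreadStep` — SPREADING THE WRAP DEFECT OF ONE DIRECTION ALONG ITS OWN LINES: after the toron gauge (✓`ToronGauge.exists_toron_gauge`) the
# `O(N²δ)`-defect sits on the wrap bonds; the gauge `g(x) := r_μ(x)^{−x_μ∕N}` (fractional powers of the wrap residual, ✓`SU2FractionalPowers`) makes EVERY bond of direction
# `μ` `O(defect∕N)`-close to the toron and perturbs the other directions only by terms `∝ 1∕N` — the η-count of `ym-ust-19200-w5` g14 (STATUS 2026-08-30 03:35:45Z)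
# (route `UnitScaleTilt`, crux K1′ `MinimiserStabilityRegPr` stmt-QuantumFields-19200, small-member exit (α)(a)∕(b), piece P3 «`RegPr` ↦ toron gauge», FILE 4b-1)

Cell `ym3-torus` (YM ladder rung R3 = continuum SU(2) Yang–Mills on T³ — a RUNG, NOT the Clay problem: not d = 4, not infinite volume,
not a mass gap); width seat `ym3-torus-px19` (gen 12); helper `--supports stmt-QuantumFields-19200`.  THEOREMS ONLY (0 `def`, 0 `sorry`, default heartbeats except ONE decl-local `maxHeartbeats 400000`).
Letters: `D a := quatToSU2 (cos a + sin a·i)` (✓`ToronGauge.D_mul`∕`D_inv`), the fractional powers `P r s := quatToSU2 (exp (s • qlog (su2Quat r)))` of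
`ym-ust-19200-w5` g14's ✓`SU2FractionalPowers` (`fracPow_zero∕one∕add∕neg`, `dist1_fracPow_le`, `dist1_cosSin_le`, `dist1_fracPow_mul_fracPow_inv_le'`) and
✓`CovariantDischargeFramedPlaquetteTransport.dist1_comm_le`, BY NAME.

WHY (w5 g14's count).  The (α)(b) comparison rows charge `(η⁻¹·δ_b)²`, `δ_b` the BONDWISE distance of the member to the comparison toron; FILE 3's wrap row is `η⁰`.
Spreading the wrap residual `r = U^σ(b_w)·D(θ_μ∕N)⁻¹` (`dist1 r ≤ ω ≤ 1∕2`) of each `μ`-line over its `N` bonds by `g(x) = P r (−val(x_μ)∕N)` gives (§1, group algebra):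
★`wrap_row_le` (the wrap bond becomes `P r (1∕N)·D`, `≤ 2ω∕N`) · ★`long_row_le` (a non-wrap `μ`-bond: `≤ dist1 e + 2ω∕N + 4ω·dist1 D`) · ★`trans_row_le` ∕ `trans_row_le_triv`
(a transverse bond between lines with residuals `r, r′`: `≤ dist1 e + 6·dist1 (r′r⁻¹) + 4ω·dist1 D′`, resp. `≤ dist1 e + 4ω + 4ω·dist1 D′`) · ★★`dist1_parallel_step_toron`
(the plaquette step READ RELATIVE TO THE TORON: `dist1 (r′r⁻¹) ≤ δ_p + dist1 e_A + dist1 e_B + 2·dist1 r·dist1 D′` — NOT F1's ✓`dist1_parallel_step`, which charges the rungs'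
distance to `1`, `≈ |θ_κ|∕N`, η⁰ in `ε₀`); and (§2) ★★★`spreading_step` — ONE DIRECTION on the torus: from «non-wrap-or-treated (`∈ T`) bonds `β`-near the toron, untreated wrap
bonds `ω`-near, `μ ∉ T`» to «`V^g` `δ_p`-flat, non-wrap-or-`∈ insert μ T` bonds within `13β + 6δ_p + 51ω∕N`, untreated wrap bonds within `12ω`».  FILE 4b-2 iterates.
HONEST SCOPE.  Lattice + compact-group bookkeeping; nothing of (α)(a)'s twisted coercivity, the (α)(b) comparison rows, `hT`, `hGF`, EX, `MinimiserStabilityRegPr` (19200) or the rung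
`YM3TorusSU2` is proved; no summit statement is proved; the Yang–Mills mass gap is NOT proved.
References: [Balaban1985Averaging] (8)–(9) p. 19, (19) p. 21, p. 24; [BrockerTomDieck1985] IV (2.2).
-/

noncomputable section

set_option autoImplicit false

open Quaternion NormedSpace
open Literature.MathematicalPhysics.QuantumLattice (su2Quat quatToSU2)
open Literature.MathematicalPhysics.QuantumFieldTheory.Balaban1983to89
open Literature.MathematicalPhysics.QuantumFieldTheory.Balaban1983to89.T4QuatExpLog (qlog)
open Literature.MathematicalPhysics.QuantumFieldTheory.Balaban1983to89.T4CubeChartGnomonic (SU2)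
open Literature.MathematicalPhysics.QuantumFieldTheory.Balaban1983to89.T4ReTrLipUnitary (plaqSmall_gaugeAct_iff)
open Literature.MathematicalPhysics.QuantumFieldTheory.Balaban1983to89.B15.PrelimIntegrations (dist1_fluct_le)
open Summit.QuantumFields.YangMills.Theorems.PoincareLipschitzHierAlignPotential (dist1_mul_mul_le)
open Summit.QuantumFields.YangMills.Theorems.TorusWrapHolonomies (natCast_pred_sitesPerDir shift_update_of_ne shift_update_self)
open Summit.QuantumFields.YangMills.Theorems.ToronGauge (D_mul D_zero D_inv)
open Summit.QuantumFields.YangMills.Theorems.SU2FractionalPowers (fracPow_zero fracPow_one fracPow_add fracPow_neg dist1_fracPow_le dist1_cosSin_le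
  dist1_fracPow_mul_fracPow_inv_le')
open Summit.QuantumFields.YangMills.Theorems.CovariantDischargeFramedPlaquetteTransport (dist1_comm_le)

namespace Summit.QuantumFields.YangMills.Theorems.ToronGaugeSpreadStep

variable {P : Params} {j : ℕ}

/-! ## §1 Group algebra of the spreading gauge -/

/-- `D(b)⁻¹·D(a)·D(b) = D(a)`. [cite: BrockerTomDieck1985, IV (2.2)] -/
theorem D_inv_mul_mul (a b : ℝ) :
    (quatToSU2 ⟨Real.cos b, Real.sin b, 0, 0⟩)⁻¹ * quatToSU2 ⟨Real.cos a, Real.sin a, 0, 0⟩ * quatToSU2 ⟨Real.cos b, Real.sin b, 0, 0⟩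
      = quatToSU2 ⟨Real.cos a, Real.sin a, 0, 0⟩ := by
  rw [mul_assoc, D_mul, add_comm, ← D_mul, ← mul_assoc, inv_mul_cancel, one_mul]

/-- ★ **THE WRAP ROW.**  `dist1 r ≤ ω ≤ 1∕2`: `P r (−(N−1)∕N) · (r·D) · (P r (−0∕N))⁻¹ · D⁻¹ = P r (1∕N)`, so its `dist1` is `≤ 2ω∕N`. [cite: Balaban1985Averaging, (19) p.21] -/
theorem wrap_row_le {r : SU2} {ω : ℝ} (hr : dist1 r ≤ ω) (hω : ω ≤ 1 / 2) (D : SU2) {N : ℕ} (hN : 2 ≤ N) :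
    dist1 (quatToSU2 (exp ((-(((N - 1 : ℕ) : ℝ)) / (N : ℝ)) • qlog (su2Quat r))) * (r * D)
        * (quatToSU2 (exp ((-((0 : ℕ) : ℝ) / (N : ℝ)) • qlog (su2Quat r))))⁻¹ * D⁻¹) ≤ 2 * ω / N := by
  have hr2 : dist1 r ≤ 1 / 2 := hr.trans hω
  have hN0 : (N : ℝ) ≠ 0 := by positivity
  have h0 : (-((0 : ℕ) : ℝ) / (N : ℝ)) = 0 := by simp
  rw [h0, fracPow_zero, inv_one, mul_one]
  have hr1 : r = quatToSU2 (exp ((1 : ℝ) • qlog (su2Quat r))) := (fracPow_one hr2).symm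
  have key : quatToSU2 (exp ((-(((N - 1 : ℕ) : ℝ)) / (N : ℝ)) • qlog (su2Quat r))) * (r * D) * D⁻¹
      = quatToSU2 (exp ((1 / (N : ℝ)) • qlog (su2Quat r))) := by
    rw [mul_assoc, mul_inv_cancel_right]
    nth_rw 2 [hr1]
    rw [← fracPow_add hr2, show (-(((N - 1 : ℕ) : ℝ)) / (N : ℝ)) + 1 = 1 / (N : ℝ) by
      rw [Nat.cast_sub (by omega : 1 ≤ N), Nat.cast_one]; field_simp; ring]
  rw [key]
  refine (dist1_fracPow_le hr2 _).trans ?_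
  rw [abs_of_nonneg (by positivity)]
  have : 2 * (1 / (N : ℝ)) * dist1 r ≤ 2 * (1 / (N : ℝ)) * ω := mul_le_mul_of_nonneg_left hr (by positivity)
  calc 2 * (1 / (N : ℝ)) * dist1 r ≤ 2 * (1 / (N : ℝ)) * ω := this
    _ = 2 * ω / N := by ring

/-- ★ **THE LONGITUDINAL ROW**: a non-wrap bond `e·D` of the spread direction at height `k` (`k + 1 ≤ N`) becomes `P r(−k∕N)·(e·D)·P r(−(k+1)∕N)⁻¹ =
[conj. of `e`]·P r(1∕N)·[commutator of `P r((k+1)∕N)` and `D`]`, so `dist1(·D⁻¹) ≤ dist1 e + 2ω∕N + 4ω·dist1 D`. [cite: Balaban1985Averaging, (19) p.21] -/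
theorem long_row_le {r : SU2} {ω : ℝ} (hr : dist1 r ≤ ω) (hω : ω ≤ 1 / 2) (e D : SU2) {N k : ℕ} (hN : 2 ≤ N) (hk : k + 1 ≤ N) :
    dist1 (quatToSU2 (exp ((-((k : ℕ) : ℝ) / (N : ℝ)) • qlog (su2Quat r))) * (e * D)
        * (quatToSU2 (exp ((-((k + 1 : ℕ) : ℝ) / (N : ℝ)) • qlog (su2Quat r))))⁻¹ * D⁻¹)
      ≤ dist1 e + 2 * ω / N + 4 * ω * dist1 D := by
  have hr2 : dist1 r ≤ 1 / 2 := hr.trans hω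
  have hω0 : 0 ≤ ω := (GaugeGroup.dist1_nonneg r).trans hr
  have hN0 : (0 : ℝ) < N := by positivity
  -- abbreviations
  set Pm := quatToSU2 (exp ((-((k : ℕ) : ℝ) / (N : ℝ)) • qlog (su2Quat r))) with hPm
  set Pk := quatToSU2 (exp ((((k : ℕ) : ℝ) / (N : ℝ)) • qlog (su2Quat r))) with hPk
  set P1 := quatToSU2 (exp (((1 : ℝ) / (N : ℝ)) • qlog (su2Quat r))) with hP1
  set Pk1 := quatToSU2 (exp ((((k + 1 : ℕ) : ℝ) / (N : ℝ)) • qlog (su2Quat r))) with hPk1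
  have hinv : (quatToSU2 (exp ((-((k + 1 : ℕ) : ℝ) / (N : ℝ)) • qlog (su2Quat r))))⁻¹ = Pk1 := by
    rw [hPk1, neg_div, fracPow_neg hr2, inv_inv]
  have hPm' : Pm = Pk⁻¹ := by rw [hPm, hPk, neg_div, fracPow_neg hr2]
  have hsplit : Pk1 = Pk * P1 := by
    rw [hPk1, hPk, hP1, ← fracPow_add hr2]
    push_cast
    rw [add_div]
  rw [hinv]
  have key : Pm * (e * D) * Pk1 * D⁻¹ = (Pk⁻¹ * e * Pk⁻¹⁻¹) * P1 * (Pk1⁻¹ * D * Pk1 * D⁻¹) := by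
    rw [hPm', hsplit]; group
  rw [key]
  refine (dist1_mul_mul_le _ _ _).trans ?_
  rw [GaugeGroup.dist1_conj]
  have h1 : dist1 P1 ≤ 2 * ω / N := by
    refine (dist1_fracPow_le hr2 _).trans ?_
    rw [abs_of_nonneg (by positivity)]
    calc 2 * (1 / (N : ℝ)) * dist1 r ≤ 2 * (1 / (N : ℝ)) * ω := mul_le_mul_of_nonneg_left hr (by positivity)
      _ = 2 * ω / N := by ring
  have h2 : dist1 (Pk1⁻¹ * D * Pk1 * D⁻¹) ≤ 4 * ω * dist1 D := by
    have h := dist1_comm_le Pk1⁻¹ D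
    rw [inv_inv, GaugeGroup.dist1_inv] at h
    refine h.trans ?_
    have hP : dist1 Pk1 ≤ 2 * ω := by
      refine (dist1_fracPow_le hr2 _).trans ?_
      have hs : |(((k + 1 : ℕ) : ℝ) / (N : ℝ))| ≤ 1 := by
        rw [abs_of_nonneg (by positivity), div_le_one hN0]; exact_mod_cast hk
      nlinarith [GaugeGroup.dist1_nonneg r, hs, abs_nonneg (((k + 1 : ℕ) : ℝ) / (N : ℝ))]
    nlinarith [GaugeGroup.dist1_nonneg D, GaugeGroup.dist1_nonneg Pk1]
  linarith

/-- ★ **THE TRANSVERSE ROW (Lipschitz form)**: a bond `e·D′` of another direction at height `k ≤ N`, between lines with residuals `r`, `r′` (`ω ≤ 1∕2`-small), becomes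
`P r(−k∕N)·(e·D′)·P r′(−k∕N)⁻¹ = [conj. of `e`]·[P r(k∕N)⁻¹·P r′(k∕N)]·[commutator]·D′`, so `dist1(·D′⁻¹) ≤ dist1 e + 6·dist1 (r′r⁻¹) + 4ω·dist1 D′`. [cite: Balaban1985Averaging, (19) p.21] -/
theorem trans_row_le {r r' : SU2} {ω : ℝ} (hr : dist1 r ≤ ω) (hr' : dist1 r' ≤ ω) (hω : ω ≤ 1 / 2) (e D : SU2) {N k : ℕ}
    (hN : 2 ≤ N) (hk : k ≤ N) :
    dist1 (quatToSU2 (exp ((-((k : ℕ) : ℝ) / (N : ℝ)) • qlog (su2Quat r))) * (e * D)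
        * (quatToSU2 (exp ((-((k : ℕ) : ℝ) / (N : ℝ)) • qlog (su2Quat r'))))⁻¹ * D⁻¹)
      ≤ dist1 e + 6 * dist1 (r' * r⁻¹) + 4 * ω * dist1 D := by
  have hr2 : dist1 r ≤ 1 / 2 := hr.trans hω
  have hr2' : dist1 r' ≤ 1 / 2 := hr'.trans hω
  have hω0 : 0 ≤ ω := (GaugeGroup.dist1_nonneg r).trans hr
  have hN0 : (0 : ℝ) < N := by positivity
  set Pk := quatToSU2 (exp ((((k : ℕ) : ℝ) / (N : ℝ)) • qlog (su2Quat r))) with hPk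
  set Pk' := quatToSU2 (exp ((((k : ℕ) : ℝ) / (N : ℝ)) • qlog (su2Quat r'))) with hPk'
  have hm : quatToSU2 (exp ((-((k : ℕ) : ℝ) / (N : ℝ)) • qlog (su2Quat r))) = Pk⁻¹ := by rw [hPk, neg_div, fracPow_neg hr2]
  have hm' : (quatToSU2 (exp ((-((k : ℕ) : ℝ) / (N : ℝ)) • qlog (su2Quat r'))))⁻¹ = Pk' := by rw [hPk', neg_div, fracPow_neg hr2', inv_inv]
  rw [hm, hm']
  have key : Pk⁻¹ * (e * D) * Pk' * D⁻¹ = (Pk⁻¹ * e * Pk⁻¹⁻¹) * (Pk⁻¹ * Pk') * (Pk'⁻¹ * D * Pk' * D⁻¹) := by group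
  rw [key]
  refine (dist1_mul_mul_le _ _ _).trans ?_
  rw [GaugeGroup.dist1_conj]
  have hs : (((k : ℕ) : ℝ) / (N : ℝ)) ∈ Set.Icc (0 : ℝ) 1 :=
    ⟨by positivity, by rw [div_le_one hN0]; exact_mod_cast hk⟩
  have h1 : dist1 (Pk⁻¹ * Pk') ≤ 6 * dist1 (r' * r⁻¹) := by
    have h := dist1_fracPow_mul_fracPow_inv_le' hr2' hr2 hs.1 hs.2
    have e1 : Pk⁻¹ * Pk' = Pk⁻¹ * (Pk' * Pk⁻¹) * Pk⁻¹⁻¹ := by group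
    rw [e1, GaugeGroup.dist1_conj]
    exact h
  have h2 : dist1 (Pk'⁻¹ * D * Pk' * D⁻¹) ≤ 4 * ω * dist1 D := by
    have h := dist1_comm_le Pk'⁻¹ D
    rw [inv_inv, GaugeGroup.dist1_inv] at h
    refine h.trans ?_
    have hP : dist1 Pk' ≤ 2 * ω := by
      refine (dist1_fracPow_le hr2' _).trans ?_
      have hs' : |(((k : ℕ) : ℝ) / (N : ℝ))| ≤ 1 := by rw [abs_of_nonneg hs.1]; exact hs.2
      nlinarith [GaugeGroup.dist1_nonneg r', hs', abs_nonneg (((k : ℕ) : ℝ) / (N : ℝ))]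
    nlinarith [GaugeGroup.dist1_nonneg D, GaugeGroup.dist1_nonneg Pk']
  linarith

/-- **THE TRANSVERSE ROW (trivial form)**: without the Lipschitz gain, `dist1(·D′⁻¹) ≤ dist1 e + 4ω + 4ω·dist1 D′`. [cite: Balaban1985Averaging, (19) p.21] -/
theorem trans_row_le_triv {r r' : SU2} {ω : ℝ} (hr : dist1 r ≤ ω) (hr' : dist1 r' ≤ ω) (hω : ω ≤ 1 / 2) (e D : SU2) {N k : ℕ}
    (hN : 2 ≤ N) (hk : k ≤ N) :
    dist1 (quatToSU2 (exp ((-((k : ℕ) : ℝ) / (N : ℝ)) • qlog (su2Quat r))) * (e * D)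
        * (quatToSU2 (exp ((-((k : ℕ) : ℝ) / (N : ℝ)) • qlog (su2Quat r'))))⁻¹ * D⁻¹)
      ≤ dist1 e + 4 * ω + 4 * ω * dist1 D := by
  have hr2 : dist1 r ≤ 1 / 2 := hr.trans hω
  have hr2' : dist1 r' ≤ 1 / 2 := hr'.trans hω
  have hω0 : 0 ≤ ω := (GaugeGroup.dist1_nonneg r).trans hr
  have hN0 : (0 : ℝ) < N := by positivity
  set Pk := quatToSU2 (exp ((((k : ℕ) : ℝ) / (N : ℝ)) • qlog (su2Quat r))) with hPk
  set Pk' := quatToSU2 (exp ((((k : ℕ) : ℝ) / (N : ℝ)) • qlog (su2Quat r'))) with hPk'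
  have hm : quatToSU2 (exp ((-((k : ℕ) : ℝ) / (N : ℝ)) • qlog (su2Quat r))) = Pk⁻¹ := by rw [hPk, neg_div, fracPow_neg hr2]
  have hm' : (quatToSU2 (exp ((-((k : ℕ) : ℝ) / (N : ℝ)) • qlog (su2Quat r'))))⁻¹ = Pk' := by rw [hPk', neg_div, fracPow_neg hr2', inv_inv]
  rw [hm, hm']
  have key : Pk⁻¹ * (e * D) * Pk' * D⁻¹ = (Pk⁻¹ * e * Pk⁻¹⁻¹) * (Pk⁻¹ * Pk') * (Pk'⁻¹ * D * Pk' * D⁻¹) := by group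
  rw [key]
  refine (dist1_mul_mul_le _ _ _).trans ?_
  rw [GaugeGroup.dist1_conj]
  have hs' : |(((k : ℕ) : ℝ) / (N : ℝ))| ≤ 1 := by
    rw [abs_of_nonneg (by positivity), div_le_one hN0]; exact_mod_cast hk
  have hP : dist1 Pk ≤ 2 * ω := by
    refine (dist1_fracPow_le hr2 _).trans ?_
    nlinarith [GaugeGroup.dist1_nonneg r, hs', abs_nonneg (((k : ℕ) : ℝ) / (N : ℝ))]
  have hP' : dist1 Pk' ≤ 2 * ω := by
    refine (dist1_fracPow_le hr2' _).trans ?_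
    nlinarith [GaugeGroup.dist1_nonneg r', hs', abs_nonneg (((k : ℕ) : ℝ) / (N : ℝ))]
  have h1 : dist1 (Pk⁻¹ * Pk') ≤ 4 * ω := by
    refine (GaugeGroup.dist1_mul_le _ _).trans ?_
    rw [GaugeGroup.dist1_inv]; linarith
  have h2 : dist1 (Pk'⁻¹ * D * Pk' * D⁻¹) ≤ 4 * ω * dist1 D := by
    have h := dist1_comm_le Pk'⁻¹ D
    rw [inv_inv, GaugeGroup.dist1_inv] at h
    refine h.trans ?_
    nlinarith [GaugeGroup.dist1_nonneg D, GaugeGroup.dist1_nonneg Pk']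
  linarith

/-- ★★ **THE PLAQUETTE STEP READ RELATIVE TO THE TORON.**  `V` `δ_p`-flat, `κ ≠ μ`; the two `κ`-rungs of the plaquette `⟨x; κ, μ⟩` are `A = e_A·D′`, `B = e_B·D′` and the `μ`-bond
`W = V⟨x, μ⟩ = r·D` with `D D′ = D′ D` (two torus elements).  Then `W′W⁻¹ = D′⁻¹·[e_A⁻¹·Π·(W e_B W⁻¹)·(r D′ r⁻¹ D′⁻¹)]·D′` (resp. `Π⁻¹`), so
`dist1 (V⟨x+e_κ, μ⟩·V⟨x, μ⟩⁻¹) ≤ δ_p + dist1 e_A + dist1 e_B + 2·dist1 r·dist1 D′` — every term `∝ η` in the member application. [cite: Balaban1985Averaging, (9) p.19] -/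
theorem dist1_parallel_step_toron {V : GaugeField P j SU2} {δp : ℝ} (hV : PlaqSmall δp V) {μ κ : Fin P.d} (hκμ : κ ≠ μ)
    (x : Site P j) (a a' : ℝ) :
    dist1 (V ⟨x.shift κ, μ⟩ * (V ⟨x, μ⟩)⁻¹)
      ≤ δp + dist1 (V ⟨x, κ⟩ * (quatToSU2 ⟨Real.cos a', Real.sin a', 0, 0⟩)⁻¹)
          + dist1 (V ⟨x.shift μ, κ⟩ * (quatToSU2 ⟨Real.cos a', Real.sin a', 0, 0⟩)⁻¹)
          + 2 * dist1 (V ⟨x, μ⟩ * (quatToSU2 ⟨Real.cos a, Real.sin a, 0, 0⟩)⁻¹) * dist1 (quatToSU2 ⟨Real.cos a', Real.sin a', 0, 0⟩) := by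
  set D := quatToSU2 ⟨Real.cos a, Real.sin a, 0, 0⟩ with hD
  set D' := quatToSU2 ⟨Real.cos a', Real.sin a', 0, 0⟩ with hD'
  set A := V ⟨x, κ⟩
  set B := V ⟨x.shift μ, κ⟩
  set W := V ⟨x, μ⟩
  set W' := V ⟨x.shift κ, μ⟩
  -- `W D′ W⁻¹ D′⁻¹` is the commutator of the residual `r = W D⁻¹` with `D′`
  have hWD : W * D' * W⁻¹ * D'⁻¹ = (W * D⁻¹) * D' * (W * D⁻¹)⁻¹ * D'⁻¹ := by
    rw [show (W * D⁻¹) * D' * (W * D⁻¹)⁻¹ = W * (D⁻¹ * D' * D) * W⁻¹ by group, hD, hD', D_inv_mul_mul]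
  have hcomm : dist1 (W * D' * W⁻¹ * D'⁻¹) ≤ 2 * dist1 (W * D⁻¹) * dist1 D' := by
    rw [hWD]; exact dist1_comm_le _ _
  rcases lt_or_gt_of_ne hκμ with h | h
  · have hp := (hV ⟨x, κ, μ, h⟩).le
    simp only [GaugeField.plaqHol] at hp
    have key : W' * W⁻¹ = D'⁻¹ * (((A * D'⁻¹)⁻¹ * (A * W' * B⁻¹ * W⁻¹) * (W * (B * D'⁻¹) * W⁻¹)) * (W * D' * W⁻¹ * D'⁻¹)) * D'⁻¹⁻¹ := by
      group
    rw [key, GaugeGroup.dist1_conj]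
    refine (GaugeGroup.dist1_mul_le _ _).trans ?_
    have h3 := dist1_mul_mul_le (A * D'⁻¹)⁻¹ (A * W' * B⁻¹ * W⁻¹) (W * (B * D'⁻¹) * W⁻¹)
    rw [GaugeGroup.dist1_inv, GaugeGroup.dist1_conj] at h3
    linarith
  · have hp := (hV ⟨x, μ, κ, h⟩).le
    simp only [GaugeField.plaqHol] at hp
    have key : W' * W⁻¹ = D'⁻¹ * (((A * D'⁻¹)⁻¹ * (W * B * W'⁻¹ * A⁻¹)⁻¹ * (W * (B * D'⁻¹) * W⁻¹)) * (W * D' * W⁻¹ * D'⁻¹)) * D'⁻¹⁻¹ := by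
      group
    rw [key, GaugeGroup.dist1_conj]
    refine (GaugeGroup.dist1_mul_le _ _).trans ?_
    have h3 := dist1_mul_mul_le (A * D'⁻¹)⁻¹ (W * B * W'⁻¹ * A⁻¹)⁻¹ (W * (B * D'⁻¹) * W⁻¹)
    rw [GaugeGroup.dist1_inv, GaugeGroup.dist1_inv, GaugeGroup.dist1_conj] at h3
    linarith

/-! ## §2 One direction on the torus -/

set_option maxHeartbeats 400000 in
/-- ★★★ **THE ONE-DIRECTION SPREADING STEP.**  `V` `δ_p`-flat, `|θ_κ| ≤ π`, toron `D_κ := D(θ_κ∕N)`; `T` the directions already spread, `μ ∉ T`; non-wrap-or-`∈ T` bonds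
`β`-near the toron, wrap bonds of directions `∉ T` `ω`-near (`ω ≤ 1∕2`).  The gauge `g(x) := P (r_μ(x)) (−val(x_μ)∕N)`, `r_μ(x) := V⟨x[μ ↦ −1], μ⟩·D_μ⁻¹`, gives: `V^g` `δ_p`-flat;
every non-wrap-or-`∈ insert μ T` bond within `13β + 6δ_p + 51ω∕N`; every wrap bond of a direction `∉ insert μ T` within `12ω`. [cite: Balaban1985Averaging, (8)-(9) p.19, (19) p.21] -/
theorem spreading_step (V : GaugeField P j SU2) (θ : Fin P.d → ℝ) (μ : Fin P.d) (T : Finset (Fin P.d)) (hμT : μ ∉ T)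
    {δp β ω : ℝ} (hδp : 0 ≤ δp) (hβ : 0 ≤ β) (hω0 : 0 ≤ ω) (hω : ω ≤ 1 / 2) (hθ : ∀ κ, |θ κ| ≤ Real.pi)
    (hV : PlaqSmall δp V)
    (hgood : ∀ b : PBond P j, (b.src b.dir ≠ -1 ∨ b.dir ∈ T) →
      dist1 (V b * (quatToSU2 ⟨Real.cos (θ b.dir / P.sitesPerDir j), Real.sin (θ b.dir / P.sitesPerDir j), 0, 0⟩)⁻¹) ≤ β)
    (hwrap : ∀ b : PBond P j, b.src b.dir = -1 → b.dir ∉ T →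
      dist1 (V b * (quatToSU2 ⟨Real.cos (θ b.dir / P.sitesPerDir j), Real.sin (θ b.dir / P.sitesPerDir j), 0, 0⟩)⁻¹) ≤ ω) :
    ∃ g : GaugeTransf P j SU2,
      PlaqSmall δp (GaugeField.gaugeAct g V) ∧
      (∀ b : PBond P j, (b.src b.dir ≠ -1 ∨ b.dir ∈ insert μ T) →
        dist1 (GaugeField.gaugeAct g V b
            * (quatToSU2 ⟨Real.cos (θ b.dir / P.sitesPerDir j), Real.sin (θ b.dir / P.sitesPerDir j), 0, 0⟩)⁻¹)
          ≤ 13 * β + 6 * δp + 51 * ω / P.sitesPerDir j) ∧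
      (∀ b : PBond P j, b.src b.dir = -1 → b.dir ∉ insert μ T →
        dist1 (GaugeField.gaugeAct g V b
            * (quatToSU2 ⟨Real.cos (θ b.dir / P.sitesPerDir j), Real.sin (θ b.dir / P.sitesPerDir j), 0, 0⟩)⁻¹)
          ≤ 12 * ω) := by
  classical
  -- the torus size
  have h2N : 2 ≤ P.sitesPerDir j := by
    have h := Nat.one_le_pow (P.m + P.K - j) P.L P.L_pos
    show 2 ≤ 2 * P.L ^ (P.m + P.K - j)
    omega
  have hN0 : (0 : ℝ) < (P.sitesPerDir j : ℝ) := by positivity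
  have hπN : ∀ κ, dist1 (quatToSU2 ⟨Real.cos (θ κ / P.sitesPerDir j), Real.sin (θ κ / P.sitesPerDir j), 0, 0⟩)
      ≤ Real.pi / P.sitesPerDir j := fun κ => by
    refine (dist1_cosSin_le _).trans ?_
    rw [abs_div, abs_of_pos hN0]
    exact div_le_div_of_nonneg_right (hθ κ) hN0.le
  have hπN' : Real.pi / (P.sitesPerDir j : ℝ) ≤ Real.pi / 2 :=
    div_le_div_of_nonneg_left Real.pi_pos.le (by norm_num) (by exact_mod_cast h2N)
  -- the wrap residual of the `μ`-line through `x` and the spreading gauge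
  set Dμ := quatToSU2 ⟨Real.cos (θ μ / P.sitesPerDir j), Real.sin (θ μ / P.sitesPerDir j), 0, 0⟩ with hDμ
  set r : Site P j → SU2 := fun x => V ⟨Function.update x μ (-1), μ⟩ * Dμ⁻¹ with hr
  have hrω : ∀ x, dist1 (r x) ≤ ω := fun x => hwrap ⟨Function.update x μ (-1), μ⟩ (by simp) hμT
  have hrμ : ∀ x : Site P j, r (x.shift μ) = r x := fun x => by
    simp only [hr, Site.shift, Function.update_idem]
  have hrκ : ∀ (x : Site P j) {κ : Fin P.d}, κ ≠ μ → r (x.shift κ) = V ⟨Site.shift (Function.update x μ (-1)) κ, μ⟩ * Dμ⁻¹ :=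
    fun x κ hκ => by rw [hr, shift_update_of_ne x (Ne.symm hκ)]
  set g : GaugeTransf P j SU2 := fun x =>
    quatToSU2 (exp ((-(((x μ).val : ℕ) : ℝ) / (P.sitesPerDir j : ℝ)) • qlog (su2Quat (r x)))) with hg
  have hact : ∀ (x : Site P j) (ν : Fin P.d), GaugeField.gaugeAct g V ⟨x, ν⟩ = g x * V ⟨x, ν⟩ * (g (x.shift ν))⁻¹ := fun x ν => rfl
  -- the representative of the coordinate after one step
  have hval_wrap : ∀ x : Site P j, x μ = -1 → (x μ).val = P.sitesPerDir j - 1 := fun x hx => by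
    rw [hx, ← natCast_pred_sitesPerDir, ZMod.val_natCast, Nat.mod_eq_of_lt (by omega)]
  have hval_wrap' : ∀ x : Site P j, x μ = -1 → ((x.shift μ) μ).val = 0 := fun x hx => by
    simp only [Site.shift, Function.update_self, hx, neg_add_cancel, ZMod.val_zero]
  have hval_step : ∀ x : Site P j, x μ ≠ -1 → ((x.shift μ) μ).val = (x μ).val + 1 := fun x hx => by
    have hlt := ZMod.val_lt (x μ)
    have hne : (x μ).val ≠ P.sitesPerDir j - 1 := fun hv =>
      hx (by rw [← ZMod.natCast_zmod_val (x μ), hv, natCast_pred_sitesPerDir])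
    simp only [Site.shift, Function.update_self]
    rw [ZMod.val_add, ZMod.val_one_eq_one_mod, Nat.mod_eq_of_lt (by omega : 1 < P.sitesPerDir j), Nat.mod_eq_of_lt (by omega)]
  have hval_trans : ∀ (x : Site P j) {κ : Fin P.d}, κ ≠ μ → ((x.shift κ) μ).val = (x μ).val := fun x κ hκ => by
    simp only [Site.shift, Function.update_of_ne (Ne.symm hκ)]
  -- THE `μ`-ROWS (wrap and non-wrap): every `μ`-bond ends within `β + 15 ω ∕ N`
  have hμrow : ∀ x : Site P j, dist1 (GaugeField.gaugeAct g V ⟨x, μ⟩ * Dμ⁻¹) ≤ β + 15 * ω / P.sitesPerDir j := by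
    intro x
    rw [hact]
    by_cases hx : x μ = -1
    · -- wrap bond: `V⟨x, μ⟩ = r x · Dμ`
      have hxw : Function.update x μ (-1) = x := by rw [← hx, Function.update_eq_self]
      have hVb : V ⟨x, μ⟩ = r x * Dμ := by rw [hr]; simp only [hxw, inv_mul_cancel_right]
      have hgx : g x = quatToSU2 (exp ((-(((P.sitesPerDir j - 1 : ℕ)) : ℝ) / (P.sitesPerDir j : ℝ)) • qlog (su2Quat (r x)))) := by
        rw [hg]; simp only [hval_wrap x hx]
      have hgx' : g (x.shift μ) = quatToSU2 (exp ((-((0 : ℕ) : ℝ) / (P.sitesPerDir j : ℝ)) • qlog (su2Quat (r x)))) := by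
        rw [hg]; simp only [hval_wrap' x hx, hrμ x]
      rw [hgx, hgx', hVb]
      refine (wrap_row_le (hrω x) hω Dμ h2N).trans ?_
      have : 2 * ω / P.sitesPerDir j ≤ 15 * ω / P.sitesPerDir j := div_le_div_of_nonneg_right (by nlinarith) hN0.le
      linarith
    · -- non-wrap bond: `V⟨x, μ⟩ = e · Dμ`, `dist1 e ≤ β`
      have he : dist1 (V ⟨x, μ⟩ * Dμ⁻¹) ≤ β := hgood ⟨x, μ⟩ (Or.inl hx)
      have hVb : V ⟨x, μ⟩ = V ⟨x, μ⟩ * Dμ⁻¹ * Dμ := by rw [inv_mul_cancel_right]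
      have hk : (x μ).val + 1 ≤ P.sitesPerDir j := ZMod.val_lt (x μ)
      have hgx' : g (x.shift μ) = quatToSU2 (exp ((-(((x μ).val + 1 : ℕ) : ℝ) / (P.sitesPerDir j : ℝ)) • qlog (su2Quat (r x)))) := by
        rw [hg]; simp only [hval_step x hx, hrμ x]
      rw [hgx', hVb]
      refine (long_row_le (hrω x) hω _ Dμ h2N hk).trans ?_
      have hD := hπN μ
      rw [← hDμ] at hD
      have h4 : 4 * ω * dist1 Dμ ≤ 13 * ω / P.sitesPerDir j := by
        calc 4 * ω * dist1 Dμ ≤ 4 * ω * (Real.pi / P.sitesPerDir j) := mul_le_mul_of_nonneg_left hD (by positivity)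
          _ = (4 * Real.pi) * ω / P.sitesPerDir j := by ring
          _ ≤ 13 * ω / P.sitesPerDir j := by
            apply div_le_div_of_nonneg_right _ hN0.le; nlinarith [Real.pi_lt_d2, hω0]
      have h2 : 2 * ω / P.sitesPerDir j + 13 * ω / P.sitesPerDir j = 15 * ω / P.sitesPerDir j := by ring
      linarith
  refine ⟨g, (plaqSmall_gaugeAct_iff δp g V).mpr hV, ?_, ?_⟩
  · -- GOOD bonds after the step
    rintro ⟨x, ν⟩ hb
    by_cases hν : ν = μ
    · subst hν
      refine (hμrow x).trans ?_
      have : 15 * ω / P.sitesPerDir j ≤ 51 * ω / P.sitesPerDir j := div_le_div_of_nonneg_right (by nlinarith) hN0.le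
      linarith
    · -- transverse bond of direction `ν ≠ μ`, good: `x ν ≠ −1 ∨ ν ∈ T`
      have hb' : x ν ≠ -1 ∨ ν ∈ T := by
        rcases hb with h | h
        · exact Or.inl h
        · exact Or.inr (Finset.mem_of_mem_insert_of_ne h hν)
      set Dν := quatToSU2 ⟨Real.cos (θ ν / P.sitesPerDir j), Real.sin (θ ν / P.sitesPerDir j), 0, 0⟩ with hDν
      have he : dist1 (V ⟨x, ν⟩ * Dν⁻¹) ≤ β := hgood ⟨x, ν⟩ hb'
      set xw : Site P j := Function.update x μ (-1) with hxw
      have hA : dist1 (V ⟨xw, ν⟩ * Dν⁻¹) ≤ β := hgood ⟨xw, ν⟩ (by simpa [hxw, Function.update_of_ne hν] using hb')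
      have hB : dist1 (V ⟨xw.shift μ, ν⟩ * Dν⁻¹) ≤ β :=
        hgood ⟨xw.shift μ, ν⟩ (by simpa [hxw, Site.shift, Function.update_of_ne hν] using hb')
      have hstep := dist1_parallel_step_toron hV hν xw (θ μ / P.sitesPerDir j) (θ ν / P.sitesPerDir j)
      have hrr : r (x.shift ν) * (r x)⁻¹ = V ⟨xw.shift ν, μ⟩ * (V ⟨xw, μ⟩)⁻¹ := by
        rw [hrκ x hν, hr]; simp only [hxw, mul_inv_rev, inv_inv]; group
      have hVb : V ⟨x, ν⟩ = V ⟨x, ν⟩ * Dν⁻¹ * Dν := by rw [inv_mul_cancel_right]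
      have hk : (x μ).val ≤ P.sitesPerDir j := (ZMod.val_lt (x μ)).le
      have hgx' : g (x.shift ν) = quatToSU2 (exp ((-(((x μ).val : ℕ) : ℝ) / (P.sitesPerDir j : ℝ)) • qlog (su2Quat (r (x.shift ν))))) := by
        rw [hg]; simp only [hval_trans x hν]
      rw [hact, hgx', hVb]
      refine (trans_row_le (hrω x) (hrω (x.shift ν)) hω _ Dν h2N hk).trans ?_
      rw [hrr]
      have hrx : dist1 (V ⟨xw, μ⟩ * Dμ⁻¹) ≤ ω := by have := hrω x; rwa [hr] at this
      have hD := hπN ν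
      rw [← hDν] at hD
      have hD0 : 0 ≤ dist1 Dν := GaugeGroup.dist1_nonneg _
      have h6 : dist1 (V ⟨xw.shift ν, μ⟩ * (V ⟨xw, μ⟩)⁻¹) ≤ δp + β + β + 2 * ω * dist1 Dν := by
        refine hstep.trans ?_
        rw [← hDμ, ← hDν]
        nlinarith [hA, hB, hrx, hD0, GaugeGroup.dist1_nonneg (V ⟨xw, μ⟩ * Dμ⁻¹)]
      have h16 : 16 * ω * dist1 Dν ≤ 51 * ω / P.sitesPerDir j := by
        calc 16 * ω * dist1 Dν ≤ 16 * ω * (Real.pi / P.sitesPerDir j) := mul_le_mul_of_nonneg_left hD (by positivity)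
          _ = (16 * Real.pi) * ω / P.sitesPerDir j := by ring
          _ ≤ 51 * ω / P.sitesPerDir j := by
            apply div_le_div_of_nonneg_right _ hN0.le; nlinarith [Real.pi_lt_d2]
      nlinarith [h6, h16, he, hD0, hω0]
  · -- UNTREATED WRAP bonds after the step (`ν ≠ μ`, `ν ∉ T`, `x ν = −1`)
    rintro ⟨x, ν⟩ hxν hνT
    have hν : ν ≠ μ := fun h => hνT (h ▸ Finset.mem_insert_self μ T)
    have hνT' : ν ∉ T := fun h => hνT (Finset.mem_insert_of_mem h)
    set Dν := quatToSU2 ⟨Real.cos (θ ν / P.sitesPerDir j), Real.sin (θ ν / P.sitesPerDir j), 0, 0⟩ with hDν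
    have he : dist1 (V ⟨x, ν⟩ * Dν⁻¹) ≤ ω := hwrap ⟨x, ν⟩ hxν hνT'
    have hVb : V ⟨x, ν⟩ = V ⟨x, ν⟩ * Dν⁻¹ * Dν := by rw [inv_mul_cancel_right]
    have hk : (x μ).val ≤ P.sitesPerDir j := (ZMod.val_lt (x μ)).le
    have hgx' : g (x.shift ν) = quatToSU2 (exp ((-(((x μ).val : ℕ) : ℝ) / (P.sitesPerDir j : ℝ)) • qlog (su2Quat (r (x.shift ν))))) := by
      rw [hg]; simp only [hval_trans x hν]
    rw [hact, hgx', hVb]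
    refine (trans_row_le_triv (hrω x) (hrω (x.shift ν)) hω _ Dν h2N hk).trans ?_
    have hD := hπN ν
    rw [← hDν] at hD
    have hD2 : dist1 Dν ≤ Real.pi / 2 := hD.trans hπN'
    have h4 : 4 * ω * dist1 Dν ≤ 4 * ω * (Real.pi / 2) := mul_le_mul_of_nonneg_left hD2 (by positivity)
    have h7 : 4 * ω * (Real.pi / 2) ≤ 7 * ω := by nlinarith [Real.pi_lt_d2, hω0]
    linarith

end Summit.QuantumFields.YangMills.Theorems.ToronGaugeSpreadStep

end
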